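/-
Copyright (c) 2026 the pub-hodgecm-mathlib formalisation cell (harness21).  Prover seat hodgecm-mathlib-K2E3-p06 (g3), Track B «K2-LIT» ∕ h413, road J ∕ R3 (d)
brick (d-w-0) «exact Euler–Poincaré indices at a ramified place», FILE B1: `[GL₂(𝒪) : I] = q + 1`.  2026-09-04.
-/
import Literature.NumberTheory.Automorphic.IwahoriGL            -- ★ `iwahoriGL`, `mem_iwahoriGL_iff`, `iwahoriGL_le_glInt`, `residue_eq_zero_iff_valuation_lt_one`
import Literature.NumberTheory.Automorphic.HeckeTransversalGL   -- ★ `mem_glInt_of_isIntegralMatrix`, `valuation_det_eq_one_of_mem_glInt`, `mem_glInt_iff`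
import Literature.NumberTheory.Automorphic.SLTwoTreeQuadraticTorusShellDecomposition   -- ★ `HermitianLatticeTree.exists_mem_glInt_coe_eq_swap` (the swap in `GL₂(𝒪)`)
import HarnessLib

/-!
# The Iwahori subgroup of `GL₂` has index `q + 1` in `GL₂(𝒪)` (Iwahori–Matsumoto 1965 §2; Serre, *Trees* II.1.1)

Topic `NumberTheory/Automorphic`; namespace `Literature.NumberTheory.Automorphic` (that of ★ `IwahoriGL`).  THEOREMS ONLY (no definition, no instance, no notation, no
named fact, no `sorry`); count-neutral helper `--supports stmt-HodgeConjecture-24833`.  Cell `pub/hodgecm-mathlib`, crux H413, Track B «K2-LIT», unit U3b, road J letter ‹J3›,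
place class (d-w): brick (d-w-0) FILE B1 (dealer K2E3-plan (g2) 2026-09-04T01:34:25Z (D16)).  For a field `F` with a valuative relation and FINITE residue field `𝓀` of
cardinality `q`: **`(iwahoriGL 2 F).relIndex (glInt 2 F) = q + 1`**.  This is the one COUNT behind the valency `q + 1` of the tree of `SL₂(F)` (FILE B2 `SLTwoTreeRegular`:
the star of the root is the `GL₂(𝒪)`-orbit of `𝒪 ⊕ ϖ𝒪`, whose stabiliser is the Iwahori subgroup) and hence behind Kottwitz's Euler–Poincaré index `[K_vertex : I] = q + 1`
of `U(1,1)` at a ramified place (FILE C).  HONEST LABEL: HC_CM is proved only modulo the 7 printed citations (2 remaining named inputs: hLiu418 = stmt-HodgeConjecture-24832,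
h413 = stmt-HodgeConjecture-24833) until rung 0 closes; elementary coset counting, nothing printed is asserted.

THE COUNT.  `I = {k ∈ GL₂(𝒪) : k₂₁ ∈ 𝔪}` (★ `mem_iwahoriGL_iff`).  Left coset representatives of `GL₂(𝒪) ∕ I`: the lower unipotents `u_r = (1 0; r 1)`, `r` running over
lifts of `𝓀`, and the swap `w = (0 1; 1 0)` — `u_r⁻¹ u_{r′} = u_{r′−r} ∈ I ⟺ r̄ = r̄′`, `w⁻¹ u_r = (r 1; 1 0) ∉ I`; and every `k ∈ GL₂(𝒪)` lies in `u_r I` with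
`r̄ = k̄₂₁ ∕ k̄₁₁` if `k₁₁` is a unit, in `w I` otherwise.  So `Option 𝓀 → GL₂(𝒪) ∕ I` is a bijection: `[GL₂(𝒪) : I] = #𝓀 + 1 = #ℙ¹(𝓀)`.

## References
* [IwahoriMatsumoto1965] N. Iwahori, H. Matsumoto, *On some Bruhat decomposition and the structure of the Hecke rings of p-adic Chevalley groups*, Publ. IHÉS 25 (1965), §2
  Prop. 2.4 (the Iwahori subgroup as the inverse image of the Borel; `[K : B] = #(G∕B)(𝔽_q)`).
* [Serre1980Trees] J.-P. Serre, *Trees* (1980), Ch. II §1.1 (the `q + 1` neighbours of a vertex of the tree of `SL₂`).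
-/

set_option autoImplicit false

noncomputable section

open scoped ValuativeRel Matrix MatrixGroups
open Matrix ValuativeRel

universe u

namespace Literature.NumberTheory.Automorphic

section IwahoriIndex

variable (F : Type u) [Field F] [ValuativeRel F]

/-- The lower unipotent `(1 0; r 1)`, `r ∈ 𝒪`, as an element of `GL₂(𝒪)`. [cite: Serre1980Trees, Ch. II §1.1] -/
theorem exists_mem_glInt_coe_eq_lowerUnipotent {r : F} (hr : r ∈ 𝒪[F]) :
    ∃ U : GL (Fin 2) F, (U : Matrix (Fin 2) (Fin 2) F) = !![1, 0; r, 1] ∧ U ∈ glInt 2 F := by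
  have hdet : (!![(1 : F), 0; r, 1]).det = 1 := by rw [Matrix.det_fin_two_of]; ring
  have hne : (!![(1 : F), 0; r, 1]).det ≠ 0 := by rw [hdet]; exact one_ne_zero
  refine ⟨Matrix.GeneralLinearGroup.mk'' _ (isUnit_iff_ne_zero.2 hne), rfl, mem_glInt_of_isIntegralMatrix (fun i j => ?_) ?_⟩
  · show !![(1 : F), 0; r, 1] i j ∈ 𝒪[F]
    fin_cases i <;> fin_cases j
    · exact one_mem _
    · exact zero_mem _
    · exact hr
    · exact one_mem _
  · show valuation F (!![(1 : F), 0; r, 1]).det = 1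
    rw [hdet, map_one]

variable {F} in
/-- Membership in the Iwahori subgroup of `GL₂`: `k ∈ GL₂(𝒪)` and `|k₂₁| < 1`. [cite: IwahoriMatsumoto1965, §2 Prop. 2.4] -/
theorem mem_iwahoriGL_two_iff (g : GL (Fin 2) F) :
    g ∈ iwahoriGL 2 F ↔ g ∈ glInt 2 F ∧ valuation F ((g : Matrix (Fin 2) (Fin 2) F) 1 0) < 1 := by
  rw [mem_iwahoriGL_iff]
  refine and_congr_right fun _ => ⟨fun h => h 1 0 (by decide), fun h i j hij => ?_⟩
  fin_cases i <;> fin_cases j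
  · exact absurd hij (by decide)
  · exact absurd hij (by decide)
  · exact h
  · exact absurd hij (by decide)

variable {F} in
/-- The left coset of `k ∈ GL₂(𝒪)` modulo the Iwahori subgroup is read off `k⁻¹ k′`: for `k k′ ∈ GL₂(𝒪)`, `k I = k′ I ↔ |(k⁻¹k′)₂₁| < 1`.
[cite: IwahoriMatsumoto1965, §2 Prop. 2.4] -/
theorem inv_mul_mem_iwahoriGL_iff {k k' : GL (Fin 2) F} (hk : k ∈ glInt 2 F) (hk' : k' ∈ glInt 2 F) :
    k⁻¹ * k' ∈ iwahoriGL 2 F ↔ valuation F (((k⁻¹ * k' : GL (Fin 2) F) : Matrix (Fin 2) (Fin 2) F) 1 0) < 1 := by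
  rw [mem_iwahoriGL_two_iff]
  exact ⟨fun h => h.2, fun h => ⟨Subgroup.mul_mem _ (Subgroup.inv_mem _ hk) hk', h⟩⟩

/-- **`[GL₂(𝒪) : I] = q + 1`** for the Iwahori subgroup `I` of `GL₂(F)` over a valued field with finite residue field of cardinality `q`: the left cosets are
represented by the lower unipotents `(1 0; r 1)`, `r̄ ∈ 𝓀`, and the swap `(0 1; 1 0)`. [cite: IwahoriMatsumoto1965, §2 Prop. 2.4] [cite: Serre1980Trees, Ch. II §1.1] -/
theorem relIndex_iwahoriGL_two_glInt [Finite 𝓀[F]] :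
    (iwahoriGL 2 F).relIndex (glInt 2 F) = Nat.card 𝓀[F] + 1 := by
  classical
  -- representatives
  have hlift : ∀ c : 𝓀[F], ∃ r : 𝒪[F], IsLocalRing.residue 𝒪[F] r = c := fun c => IsLocalRing.residue_surjective c
  choose s hs using hlift
  have hU : ∀ c : 𝓀[F], ∃ U : GL (Fin 2) F, (U : Matrix (Fin 2) (Fin 2) F) = !![1, 0; ((s c : 𝒪[F]) : F), 1] ∧ U ∈ glInt 2 F :=
    fun c => exists_mem_glInt_coe_eq_lowerUnipotent F (s c).2
  choose U hUcoe hUK using hU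
  obtain ⟨W, hWcoe, hWK⟩ := HermitianLatticeTree.exists_mem_glInt_coe_eq_swap (F := F)
  -- the map `Option 𝓀 → GL₂(𝒪) ⧸ I`
  let I' : Subgroup ↥(glInt 2 F) := (iwahoriGL 2 F).subgroupOf (glInt 2 F)
  let f : Option 𝓀[F] → ↥(glInt 2 F) ⧸ I' := fun o =>
    match o with
    | none => QuotientGroup.mk ⟨W, hWK⟩
    | some c => QuotientGroup.mk ⟨U c, hUK c⟩
  -- coset computations: `(U c)⁻¹ (U c′)`, `W⁻¹ (U c)`, `(U c)⁻¹ k`, `W⁻¹ k`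
  have hUinv : ∀ c : 𝓀[F], (((U c)⁻¹ : GL (Fin 2) F) : Matrix (Fin 2) (Fin 2) F) = !![1, 0; -((s c : 𝒪[F]) : F), 1] := by
    intro c
    rw [Matrix.coe_units_inv, hUcoe, Matrix.inv_eq_left_inv]
    rw [Matrix.mul_fin_two, Matrix.one_fin_two]
    congr 1
    simp
  have hWinv : ((W⁻¹ : GL (Fin 2) F) : Matrix (Fin 2) (Fin 2) F) = !![0, 1; 1, 0] := by
    rw [Matrix.coe_units_inv, hWcoe, Matrix.inv_eq_left_inv]
    rw [Matrix.mul_fin_two, Matrix.one_fin_two]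
    congr 1
    simp
  have key_eq : ∀ (a b : ↥(glInt 2 F)), (QuotientGroup.mk a : ↥(glInt 2 F) ⧸ I') = QuotientGroup.mk b ↔
      valuation F ((((a : GL (Fin 2) F)⁻¹ * (b : GL (Fin 2) F) : GL (Fin 2) F) : Matrix (Fin 2) (Fin 2) F) 1 0) < 1 := by
    intro a b
    rw [QuotientGroup.eq, Subgroup.mem_subgroupOf, Subgroup.coe_mul, Subgroup.coe_inv]
    exact inv_mul_mem_iwahoriGL_iff a.2 b.2
  have hbij : Function.Bijective f := by
    constructor
    · -- injective
      intro o o' h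
      rcases o with _ | c <;> rcases o' with _ | c'
      · rfl
      · exfalso
        have h1 := (key_eq _ _).1 h
        rw [Units.val_mul, hWinv, hUcoe] at h1
        simp [Matrix.mul_apply, Fin.sum_univ_two] at h1
      · exfalso
        have h1 := (key_eq _ _).1 h
        rw [Units.val_mul, hUinv, hWcoe] at h1
        simp [Matrix.mul_apply, Fin.sum_univ_two] at h1
      · have h1 := (key_eq _ _).1 h
        rw [Units.val_mul, hUinv, hUcoe] at h1
        simp only [Matrix.mul_apply, Fin.sum_univ_two, mul_one, one_mul, Matrix.of_apply, Matrix.cons_val',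
          Matrix.cons_val_zero, Matrix.cons_val_one, Matrix.cons_val_fin_one, Matrix.empty_val'] at h1
        -- `h1 : valuation F (-s c + s c') < 1`
        have h2 : IsLocalRing.residue 𝒪[F] (s c' - s c) = 0 := by
          rw [residue_eq_zero_iff_valuation_lt_one]
          have : ((s c' - s c : 𝒪[F]) : F) = -((s c : 𝒪[F]) : F) + ((s c' : 𝒪[F]) : F) := by push_cast; ring
          rw [this]; exact h1
        rw [map_sub, sub_eq_zero, hs, hs] at h2
        rw [h2]
    · -- surjective
      intro x
      induction x using QuotientGroup.induction_on with
      | H k =>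
        obtain ⟨k, hk⟩ := k
        have hk00 : (k : Matrix (Fin 2) (Fin 2) F) 0 0 ∈ 𝒪[F] := ((mem_glInt_iff k).1 hk).1 0 0
        have hk10 : (k : Matrix (Fin 2) (Fin 2) F) 1 0 ∈ 𝒪[F] := ((mem_glInt_iff k).1 hk).1 1 0
        rcases ((Valuation.mem_integer_iff _ _).1 hk00).lt_or_eq with hlt | hunit
        · -- `|k₁₁| < 1`: the coset of `W`
          refine ⟨none, ?_⟩
          show (QuotientGroup.mk ⟨W, hWK⟩ : ↥(glInt 2 F) ⧸ I') = QuotientGroup.mk ⟨k, hk⟩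
          rw [key_eq, Units.val_mul, hWinv]
          simp only [Matrix.mul_apply, Fin.sum_univ_two, Matrix.of_apply, Matrix.cons_val', Matrix.cons_val_zero, Matrix.cons_val_one,
            Matrix.cons_val_fin_one, Matrix.empty_val', zero_mul, one_mul, add_zero]
          exact hlt
        · -- `k₁₁` a unit: the coset of `U c`, `c = k̄₂₁ k̄₁₁⁻¹`
          have hu : IsUnit (⟨(k : Matrix (Fin 2) (Fin 2) F) 0 0, hk00⟩ : 𝒪[F]) :=
            (Valuation.Integers.isUnit_iff_valuation_eq_one (Valuation.integer.integers (valuation F))).2 hunit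
          set c : 𝓀[F] := IsLocalRing.residue 𝒪[F] ⟨(k : Matrix (Fin 2) (Fin 2) F) 1 0, hk10⟩ * (IsLocalRing.residue 𝒪[F] ⟨(k : Matrix (Fin 2) (Fin 2) F) 0 0, hk00⟩)⁻¹ with hc
          refine ⟨some c, ?_⟩
          show (QuotientGroup.mk ⟨U c, hUK c⟩ : ↥(glInt 2 F) ⧸ I') = QuotientGroup.mk ⟨k, hk⟩
          rw [key_eq, Units.val_mul, hUinv]
          simp only [Matrix.mul_apply, Fin.sum_univ_two, Matrix.of_apply, Matrix.cons_val', Matrix.cons_val_zero, Matrix.cons_val_one,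
            Matrix.cons_val_fin_one, Matrix.empty_val', one_mul]
          -- goal: `valuation F (-(s c) * k 0 0 + k 1 0) < 1`
          have hres : IsLocalRing.residue 𝒪[F] (-(s c) * ⟨(k : Matrix (Fin 2) (Fin 2) F) 0 0, hk00⟩ + ⟨(k : Matrix (Fin 2) (Fin 2) F) 1 0, hk10⟩) = 0 := by
            have hk0 : IsLocalRing.residue 𝒪[F] ⟨(k : Matrix (Fin 2) (Fin 2) F) 0 0, hk00⟩ ≠ 0 := (IsLocalRing.residue_ne_zero_iff_isUnit _).2 hu
            rw [map_add, map_mul, map_neg, hs, hc, neg_mul, inv_mul_cancel_right₀ hk0, neg_add_cancel]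
          rw [residue_eq_zero_iff_valuation_lt_one] at hres
          simpa using hres
  haveI : Fintype 𝓀[F] := Fintype.ofFinite _
  rw [Subgroup.relIndex, Subgroup.index_eq_card, ← Nat.card_eq_of_bijective f hbij, Nat.card_eq_fintype_card (α := Option 𝓀[F]),
    Fintype.card_option, Nat.card_eq_fintype_card]

end IwahoriIndex

end Literature.NumberTheory.Automorphic

end
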